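import Summits.CriticalPhenomena.PercolationContinuityZ3.Theorems.Transplant.SkelConcFaceRegion
import Summits.CriticalPhenomena.PercolationContinuityZ3.Theorems.Transplant.SkelTubeSub
import Summits.CriticalPhenomena.PercolationContinuityZ3.Theorems.Transplant.SkelConcExcess
import Summits.CriticalPhenomena.PercolationContinuityZ3.Theorems.Transplant.KNCells2Cover
import HarnessLib

/-!
# L6 (F), part 2 — the FACE STEP `cond_j` over the cell geometry of record `Skel.cellGeomSG` (generic re-typing of `BoxProdZ2ConcFaceStep`,
# SHEAR-SCOPE §3.9 Layer 6 (F)): the law `Wt` of (30) is a subbox weighting of the window graph `Skel.winGraph G w₀ rE` on the face-step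
# window `Win w₀ (farAS x du j) rE`, and of `winGraph G w₀ R` (`R ≥ rE, rQ_a(x)`) on the maximal fresh region `E^far ∖ Stub_j`; positive-weight
# entrances into the latter are deep (from the cube span or the stub: depth `≤ R₀ + 1`); hence the RIM EXCESS bound from the excess radius at
# the running parameter (`Skel.real_rim_le_of_radius`, hp-8 g22)

builds on p205010 (kernel theorem, internal audit signed; external expert review pending) — nothing in this file uses p205010.
Lane `prim-bschramm`, typed by the `prim-hp-8` lineage (gen 24) on the general-node order of battle (lead 2026-08-20T19:11:07Z (i));
helper file (`--supports stmt-CriticalPhenomena-4575 --as helper`).  NEW FILE over `SkelConcFaceRegion` (part 1), `SkelTubeSub` (p2-g3),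
`SkelConcExcess` (hp-8 g22).

SCHEME-PARAMETRIC: every statement is over an arbitrary lag-1 anchored scheme `S : KSchA V ℕ` whose geometry IS the geometry of record,
`hΓ : S.Γ = Skel.cellGeomSG Φ C w₀ Λ` (instantiate with stmt-g7's `SkelConc.concSchemeSG Φ C w₀ Λ q δc`, `hΓ := rfl`), under p2-g3's
`Skel.WFS C Λ`, for a valid history `S.Valid₂ G h e` examining `x = tgt e` at anchors `(a, a')` and an onward direction `du`.
Port remarks.  The product took the THIN tube `B(w₀, rE)` for both subbox facts, using that an `E_{w,v}`-neighbour of the far region is joined by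
a planar edge (same fibre); over a skeleton the `hout` side-condition of `Skel.isSubbox_Wt_win` is discharged by SEPARATION instead of radii:
the between-box span is `G`-separated from `E^far` (`LevelGeom.Btw_sep_Efar`), the explored region from the habitat (`Valid₂.sep_habitat`), and
the cube span `Q_a(x)` from the face-step window (`Skel.sep_Q_Win_farAS`, planar gap `2`); only on the maximal fresh region can the cube span
touch (planar levels `5r | 5r + 1`), whence `R ≥ rQ_a(x)` there and the entrance depth `R₀ ≥ rQ_a(x)`; `rB` is never needed.
* §1 `KSchA.Wt_eq_zero_of_not_mem_edgeSet` (any scheme, any graph);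
* §2 **`isSubbox_Wt_fresh`** (`Dd ⊆ E^far` off the stub, window graph of depth `R ≥ rE, rQ_a(x)`), **`isSubbox_Wt_faceWin`** (the face-step
  window, depth `rE` exactly), `Win_farAS_subset_Sx`, `root_not_mem_Win_farAS`;
* §3 **`entrance_faceFresh`** (depth `≤ R₀ + 1`), `sub_mem_box_of_mem_Efar` (planar diameter `50 r`), **`rim_excess_face`**:
  `P_{Wt}(⋃_{t ∈ Rim} w₀ ↔ t) ≤ η` for the rim `Rim = {v ∈ Win w₀ (farAS x du j) rE : d_G(w₀, v) > Rt − L'}` once `R₁ ≤ Rt − L'`, `R₁` an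
  excess radius at the running parameter in the shape of `Skel.exists_excess_radius(_uniform)` at the centre `w₀` (entrance depth `R₀ + 1`,
  planar diameter `50 r`).
[cite: KozmaNitzan2024, §4 p. 27 ((30)), p. 30 (Step III), p. 31 (D is a subbox of Ω), Lemma 12 (p. 24)] [cite: MartineauSevero2019, Cor. 2.2]
-/

noncomputable section

open MeasureTheory
open scoped Classical

namespace Summit.CriticalPhenomena.PercolationContinuityZ3.Theorems

namespace Transplant

open Literature.Probability.Percolation Literature.Probability.LatticeModels SimpleGraph KNCells KNLevels GadgetSystem Contour
open Literature.Probability.Percolation.KozmaNitzan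
open Literature.Probability.Percolation.KozmaNitzan.Cells (oth oth_ne sgOf sgOf_sign stepVec_apply_fst stepVec_apply_oth eq_oth_of_ne oth_oth)
open Literature.Barriers.CriticalPhenomena (graphBall graphBall_finite mem_graphBall_self graphBall_mono)
open BoxProdZ2 (ConcRadiiG mem_graphBall_succ_of_adj)

/-! ## §1 The law of (30) vanishes off the edges of the graph -/

namespace KNCells.KSchA

variable {V : Type} [DecidableEq V] {A : Type*} {G : SimpleGraph V} [G.LocallyFinite] {S : KSchA V A}
variable {h : ProbeHistory V} {e : Site 2 × MDir} {a a' : A} {du : MDir} {j : ℕ} {o : Finset (Sym2 V)}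

/-- `Wt` vanishes off the edges of `G` (the pinned pairs are edges of `G`; elsewhere it is the graph weighting). [folklore] -/
theorem Wt_eq_zero_of_not_mem_edgeSet {e' : Sym2 V} (he : e' ∉ G.edgeSet) : S.Wt G h e a a' du j o e' = 0 := by
  by_cases hm : e' ∈ wireSet (↑(S.Sx G h e a a' du) : Set V)
  · have hF : e' ∉ S.Fj G h e a a' du j := fun h' => by
      unfold KSchA.Fj at h'
      exact he (mem_edgesIn_iff.1 h').1
    rw [Wt_apply_of_not_mem_Fj hm hF, KNLevels.lattW_apply, if_neg he]
  · exact Wt_apply_of_not_mem_wireSet hm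

end KNCells.KSchA

/-! ## §2 The two subbox facts of the face step -/

namespace PCells

/-- Points of `EfarN x du` differ by at most `50 r` in every coordinate (`EfarN ⊆ cen x + Λ_{25r}`). [folklore] -/
theorem sub_mem_box_of_mem_EfarN (C : PCells) {x : Site 2} {du : MDir} {t t' : Site 2} (ht : t ∈ C.EfarN x du) (ht' : t' ∈ C.EfarN x du) :
    t - t' ∈ box 2 (50 * C.r) := by
  rw [EfarN, mem_psBox_iff] at ht ht'
  rw [mem_box]
  intro i
  simp only [Pi.sub_apply]
  push_cast
  have hr := C.one_le_r
  by_cases hi : i = du.1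
  · subst hi
    rcases sgOf_sign du with hs | hs <;> rw [hs] at ht ht' <;> constructor <;> nlinarith [ht.1.1, ht.1.2, ht'.1.1, ht'.1.2]
  · rw [eq_oth_of_ne hi]; constructor <;> linarith [ht.2.1, ht.2.2, ht'.2.1, ht'.2.2]

end PCells

namespace Skel

open PlanarSkeletonConc

variable {V : Type} [DecidableEq V] {G : SimpleGraph V} [G.LocallyFinite] (Φ : PlanarSkeletonConc G)
variable {C : PCells} {w₀ : V} {Λ : ConcRadiiG} {S : KSchA V ℕ}
variable (hΓ : S.Γ = cellGeomSG Φ C w₀ Λ) (hΛ : WFS C Λ)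
variable {h : ProbeHistory V} {e : Site 2 × MDir} (hV : S.Valid₂ G h e) {a a' : ℕ} {du : MDir} (hdu : du ∈ S.onward G h (tgt e))
variable {j : ℕ} {o : Finset (Sym2 V)}

include hΓ hΛ hV hdu

omit hΓ hΛ hV hdu in
/-- `E^far_{a'}(w + δw, du)` misses `E_{w,v}` of the incoming edge when `du` is not the way back (planar footprints). [cite: KozmaNitzan2024, §4 p. 26] -/
theorem Efar_disjoint_Ewv' (a a' : ℕ) (w : Site 2) {δw du : MDir} (hne : du ≠ rev δw) :
    Disjoint ((cellGeomSG Φ C w₀ Λ).Efar a' (w + stepVec δw) du) ((cellGeomSG Φ C w₀ Λ).Ewv a w δw) := by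
  have h := C.EwvN_disjoint_EfarN w hne
  rw [PCells.EwvN, Finset.disjoint_union_left] at h
  change Disjoint (Φ.VWin w₀ (C.EfarN (w + stepVec δw) du) (Λ.rE a' (w + stepVec δw) du))
    (Φ.VWin w₀ (C.BtwN w δw) (Λ.rB a w δw) ∪ Φ.VWin w₀ (C.Q (w + stepVec δw)) (Λ.rQ a (w + stepVec δw)))
  rw [Finset.disjoint_union_right]
  exact ⟨disjoint_VWin h.1.symm _ _, disjoint_VWin h.2.symm _ _⟩

/-- **Every `Dd ⊆ E^far_{a'}(x, du)` missing `Stub_j` is a subbox of `Wt` in the window graph of any depth `R ≥ rE_{a'}(x,du), rQ_a(x)`**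
(the explored region and the between-box span are `G`-separated from `E^far`; a cube-span neighbour has depth `≤ rQ_a(x)`, a far-region
neighbour depth `≤ rE`). [cite: KozmaNitzan2024, §4 p. 31 (D is a subbox of Ω)] -/
theorem isSubbox_Wt_fresh {R : ℕ} (hE : Λ.rE a' (tgt e) du ≤ R) (hQ : Λ.rQ a (tgt e) ≤ R) {Dd : Finset V}
    (hDd : Dd ⊆ S.Γ.Efar a' (tgt e) du) (hdS : Disjoint Dd (S.Γ.Stub a' (tgt e) du j)) :
    KNLevels.IsSubbox (winGraph G w₀ R) (S.Wt G h e a a' du j o) S.p Dd := by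
  obtain ⟨Γ, p, δc⟩ := S
  cases hΓ
  have hne : du ≠ rev e.2 := KSchA.du_ne_rev₂ hV hdu
  have hL := levelGeomSG Φ C w₀ hΛ
  refine isSubbox_Wt_win G w₀ R hL (qSepGeomSG Φ C w₀) hV hdu (b := a) (hDd.trans Finset.subset_union_right)
    (fun u hu => by unfold KSchA.Sx; exact Finset.mem_union_right _ (hDd hu)) ?_ ?_ ?_
  · exact Finset.disjoint_union_right.2
      ⟨(Efar_disjoint_Ewv' Φ a a' e.1 hne).mono_left hDd, hdS⟩
  · intro u hu
    have hu' : u ∈ Φ.VWin w₀ (C.EfarN (tgt e) du) (Λ.rE a' (tgt e) du) := hDd hu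
    exact graphBall_mono G w₀ hE (mem_graphBall_of_mem_VWin hu')
  · intro v hv x hx hadj
    rcases Finset.mem_union.1 hx with hx | hx
    · rw [CellGeom.Ewv] at hx
      rcases Finset.mem_union.1 hx with hx | hx
      · exact absurd hadj (hL.Btw_sep_Efar a a' e.1 e.2 du hne x hx v (hDd hv)).2
      · have hx' : x ∈ Φ.VWin w₀ (C.Q (e.1 + stepVec e.2)) (Λ.rQ a (e.1 + stepVec e.2)) := hx
        exact graphBall_mono G w₀ hQ (mem_graphBall_of_mem_VWin hx')
    · have hx' : x ∈ Φ.VWin w₀ (C.EfarN (tgt e) du) (Λ.rE a' (tgt e) du) := hx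
      exact graphBall_mono G w₀ hE (mem_graphBall_of_mem_VWin hx')

/-- **The face-step window `Win w₀ (farAS x du j) rE` is a subbox of `Wt` in the window graph of depth `rE = rE_{a'}(x, du)`** — no hypothesis
on `rB`, `rQ`: nothing of `E_{w,v}` is `G`-adjacent to it. [cite: KozmaNitzan2024, §4 p. 31 (D is a subbox of Ω), p. 30 (Step III)] -/
theorem isSubbox_Wt_faceWin :
    KNLevels.IsSubbox (winGraph G w₀ (Λ.rE a' (tgt e) du)) (S.Wt G h e a a' du j o) S.p
      (Φ.Win w₀ (C.farAS (tgt e) du j) (Λ.rE a' (tgt e) du)) := by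
  obtain ⟨Γ, p, δc⟩ := S
  cases hΓ
  have hne : du ≠ rev e.2 := KSchA.du_ne_rev₂ hV hdu
  have hL := levelGeomSG Φ C w₀ hΛ
  have hDd : Φ.Win w₀ (C.farAS (tgt e) du j) (Λ.rE a' (tgt e) du) ⊆ (cellGeomSG Φ C w₀ Λ).Efar a' (tgt e) du :=
    Win_farAS_subset_Efar Φ C w₀ (hΛ.one_le_rE a' (tgt e) du) j
  refine isSubbox_Wt_win G w₀ _ hL (qSepGeomSG Φ C w₀) hV hdu (b := a) (hDd.trans Finset.subset_union_right)
    (fun u hu => by unfold KSchA.Sx; exact Finset.mem_union_right _ (hDd hu)) ?_ (fun u hu => (Φ.mem_Win.1 hu).1) ?_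
  · exact Finset.disjoint_union_right.2
      ⟨disjoint_Win_farAS_Ewv Φ C w₀ a e.1 hne j _, disjoint_Win_farAS_Stub Φ C w₀ a' (tgt e) du j _⟩
  · intro v hv x hx hadj
    rcases Finset.mem_union.1 hx with hx | hx
    · rw [CellGeom.Ewv] at hx
      rcases Finset.mem_union.1 hx with hx | hx
      · exact absurd hadj (hL.Btw_sep_Efar a a' e.1 e.2 du hne x hx v (hDd hv)).2
      · exact absurd hadj (sep_Q_Win_farAS Φ C w₀ a (tgt e) du j _ x hx v hv).2
    · have hx' : x ∈ Φ.VWin w₀ (C.EfarN (tgt e) du) (Λ.rE a' (tgt e) du) := hx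
      exact mem_graphBall_of_mem_VWin hx'

omit hV hdu in
/-- The face-step window lies in the support `Sx = E_i ∪ E_{w,v} ∪ E^far` of `Wt`. [folklore] -/
theorem Win_farAS_subset_Sx : Φ.Win w₀ (C.farAS (tgt e) du j) (Λ.rE a' (tgt e) du) ⊆ S.Sx G h e a a' du := by
  obtain ⟨Γ, p, δc⟩ := S
  cases hΓ
  intro u hu
  unfold KSchA.Sx
  exact Finset.mem_union_right _ (Win_farAS_subset_Efar Φ C w₀ (hΛ.one_le_rE a' (tgt e) du) j hu)

/-- The root lies off the face-step window (it is explored; the window is fresh). [folklore] -/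
theorem root_not_mem_Win_farAS : S.Γ.root ∉ Φ.Win w₀ (C.farAS (tgt e) du j) (Λ.rE a' (tgt e) du) := by
  obtain ⟨Γ, p, δc⟩ := S
  cases hΓ
  exact KSchA.root_not_mem_of_fresh (levelGeomSG Φ C w₀ hΛ) (qSepGeomSG Φ C w₀) hV hdu (a := a')
    ((Win_farAS_subset_Efar Φ C w₀ (hΛ.one_le_rE a' (tgt e) du) j).trans Finset.subset_union_right)

/-! ## §3 Entrances into the maximal fresh region are deep; the rim excess -/

/-- **Entrances into `E^far ∖ Stub_j` are deep**: a positive-weight edge of `Wt` from outside `E^far_{a'}(x,du) ∖ Stub_j` into it starts in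
the cube span `Q_a(x)` or in the stub span (the explored region and the between-box span are `G`-separated from `E^far`), so it lands at
depth `≤ R₀ + 1` once `R₀ ≥ rQ_a(x)` and `R₀ ≥` the stub profile `ρ_{a'}(x, du, ·)`. [cite: KozmaNitzan2024, §4 pp. 26, 31] -/
theorem entrance_faceFresh {R₀ : ℕ} (hQ : Λ.rQ a (tgt e) ≤ R₀) (hρ : ∀ ℓ, Λ.ρ a' (tgt e) du ℓ ≤ R₀) {y b : V}
    (hy : y ∉ S.Γ.Efar a' (tgt e) du \ S.Γ.Stub a' (tgt e) du j) (hb : b ∈ S.Γ.Efar a' (tgt e) du \ S.Γ.Stub a' (tgt e) du j)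
    (hadj : G.Adj y b) (hw : S.Wt G h e a a' du j o s(y, b) ≠ 0) : b ∈ graphBall G w₀ (R₀ + 1) := by
  obtain ⟨Γ, p, δc⟩ := S
  cases hΓ
  have hne : du ≠ rev e.2 := KSchA.du_ne_rev₂ hV hdu
  have hL := levelGeomSG Φ C w₀ hΛ
  have hbE : b ∈ (cellGeomSG Φ C w₀ Λ).Efar a' (tgt e) du := (Finset.mem_sdiff.1 hb).1
  -- the pair lies inside the support `Sx`
  have hm : s(y, b) ∈ wireSet (↑(KSchA.Sx G ⟨cellGeomSG Φ C w₀ Λ, p, δc⟩ h e a a' du) : Set V) := by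
    by_contra hm; exact hw (KSchA.Wt_apply_of_not_mem_wireSet hm)
  have hyS : y ∈ KSchA.Sx G ⟨cellGeomSG Φ C w₀ Λ, p, δc⟩ h e a a' du := Finset.mem_coe.1 (mk_mem_wireSet_iff.1 hm).1
  unfold KSchA.Sx at hyS
  rcases Finset.mem_union.1 hyS with hyS | hyE
  · rcases Finset.mem_union.1 hyS with hyV | hyW
    · -- explored: separated from the habitat
      exact absurd hadj (KSchA.Valid₂.sep_habitat hL (qSepGeomSG Φ C w₀) hV hdu (a := a) (a' := a') y hyV b
        (Finset.mem_union_right _ hbE)).2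
    · rw [CellGeom.Ewv] at hyW
      rcases Finset.mem_union.1 hyW with hyB | hyQ
      · -- between-box span: separated from `E^far`
        exact absurd hadj (hL.Btw_sep_Efar a a' e.1 e.2 du hne y hyB b hbE).2
      · -- cube span: depth `≤ rQ_a(x)`
        have hyQ' : y ∈ Φ.VWin w₀ (C.Q (e.1 + stepVec e.2)) (Λ.rQ a (e.1 + stepVec e.2)) := hyQ
        exact mem_graphBall_succ_of_adj G (graphBall_mono G w₀ hQ (mem_graphBall_of_mem_VWin hyQ')) hadj
  · -- in `E^far` but not fresh: in the stub span, depth `≤ ρ`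
    have hySt : y ∈ (cellGeomSG Φ C w₀ Λ).Stub a' (tgt e) du j := by
      by_contra h'; exact hy (Finset.mem_sdiff.2 ⟨hyE, h'⟩)
    have hySt' : y ∈ Φ.VStair w₀ (C.Stub (tgt e) du j) (prof C Λ a' (tgt e) du) := hySt
    exact mem_graphBall_succ_of_adj G (graphBall_mono G w₀ (hρ _) (mem_of_mem_VStair hySt').2) hadj

/-- **The rim excess of the face step is `≤ η`.**  With `Rim = {v ∈ Win w₀ (farAS x du j) rE : v ∉ B_G(w₀, Rt − L')}` (in the step: `Rt =
rM_{a'}(x + du)`, the rim part of the enlarged target), an entrance depth `R₀ ≥ rQ_a(x), sup ρ_{a'}(x,du,·)`, and `R₁ ≤ Rt − L'` an excess radius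
at the running parameter for the centre `w₀`, entrance depth `R₀ + 1` and planar diameter `50 r` (the conclusion of `Skel.exists_excess_radius`,
or of hp-8's centre-uniform `exists_excess_radius_uniform` specialised at `w₀`): `P_{Wt}(⋃_{t ∈ Rim} w₀ ↔ t) ≤ η`.  The habitat of the excess
event is the maximal fresh region `E^far ∖ Stub_j`, a subbox in the window graph of depth `max(rE, rQ_a(x))`.
[cite: KozmaNitzan2024, §4 Lemma 12 (p. 24)] [cite: MartineauSevero2019, Cor. 2.2] -/
theorem rim_excess_face [Countable V] {R₀ : ℕ} (hQ : Λ.rQ a (tgt e) ≤ R₀) (hρ : ∀ ℓ, Λ.ρ a' (tgt e) du ℓ ≤ R₀)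
    {Rt L' : ℕ} {η : ℝ} {R₁ : ℕ}
    (hR₁ : ∀ R', R₁ ≤ R' → ∀ (Rw : ℕ) (D' A' : Finset V), (∀ d ∈ D', d ∈ graphBall G w₀ Rw) →
      (∀ d ∈ D', ∀ d' ∈ D', Φ.φ d - Φ.φ d' ∈ box 2 (50 * C.r)) → A' ⊆ D' → (∀ a ∈ A', a ∈ graphBall G w₀ (R₀ + 1)) →
        (bondPercolation G S.p).real (excess G w₀ R' D' A') ≤ η)
    (hR : R₁ ≤ Rt - L') :
    (prodBernoulli (S.Wt G h e a a' du j o)).real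
      (⋃ t ∈ (Φ.Win w₀ (C.farAS (tgt e) du j) (Λ.rE a' (tgt e) du)).filter (fun v => v ∉ graphBall G w₀ (Rt - L')),
        openConn w₀ t) ≤ η := by
  obtain ⟨Γ, p, δc⟩ := S
  cases hΓ
  -- the habitat: the maximal fresh region, a subbox in the window graph of depth `max(rE, rQ_a(x))`
  set R := max (Λ.rE a' (tgt e) du) (Λ.rQ a (tgt e)) with hRdef
  set D : Finset V := (cellGeomSG Φ C w₀ Λ).Efar a' (tgt e) du \ (cellGeomSG Φ C w₀ Λ).Stub a' (tgt e) du j with hD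
  have hDE : D ⊆ (cellGeomSG Φ C w₀ Λ).Efar a' (tgt e) du := Finset.sdiff_subset
  have hDE' : D ⊆ Φ.VWin w₀ (C.EfarN (tgt e) du) (Λ.rE a' (tgt e) du) := hDE
  have hWD := isSubbox_Wt_fresh Φ (S := ⟨cellGeomSG Φ C w₀ Λ, p, δc⟩) rfl hΛ hV hdu (j := j) (o := o)
    (show Λ.rE a' (tgt e) du ≤ R from le_max_left _ _) (show Λ.rQ a (tgt e) ≤ R from le_max_right _ _) hDE Finset.sdiff_disjoint
  -- hp-8 g22's excess lemma is stated with the classical `DecidableEq`; bridge by subsingleton-ness of instances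
  have hWD' : @KNLevels.IsSubbox V (fun a b => Classical.propDecidable (a = b)) (winGraph G w₀ R) _
      (KSchA.Wt G ⟨cellGeomSG Φ C w₀ Λ, p, δc⟩ h e a a' du j o) p D := by
    convert hWD
  have hA : ∀ y b, y ∉ D → b ∈ D → G.Adj y b → KSchA.Wt G ⟨cellGeomSG Φ C w₀ Λ, p, δc⟩ h e a a' du j o s(y, b) ≠ 0 →
      b ∈ graphBall G w₀ (R₀ + 1) :=
    fun y b hy hb hadj hw => entrance_faceFresh Φ (S := ⟨cellGeomSG Φ C w₀ Λ, p, δc⟩) rfl hΛ hV hdu hQ hρ hy hb hadj hw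
  have hRg : Φ.Win w₀ (C.farAS (tgt e) du j) (Λ.rE a' (tgt e) du) ⊆ D := fun u hu =>
    Finset.mem_sdiff.2 ⟨Win_farAS_subset_Efar Φ C w₀ (hΛ.one_le_rE a' (tgt e) du) j hu,
      Finset.disjoint_left.1 (disjoint_Win_farAS_Stub Φ C w₀ a' (tgt e) du j _) hu⟩
  have hDπ : ∀ v ∈ D, v ∈ graphBall G w₀ R := fun v hv =>
    graphBall_mono G w₀ (le_max_left _ _) (mem_graphBall_of_mem_VWin (hDE' hv))
  have hroot : w₀ ∉ D := KSchA.root_not_mem_of_fresh (S := ⟨cellGeomSG Φ C w₀ Λ, p, δc⟩)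
    (levelGeomSG Φ C w₀ hΛ) (qSepGeomSG Φ C w₀) hV hdu (a := a) (hDE.trans Finset.subset_union_right)
  refine real_rim_le_of_radius Φ hWD' hDπ (fun e' he' => KSchA.Wt_eq_zero_of_not_mem_edgeSet he') hroot
    ((Finset.filter_subset _ _).trans hRg) (fun t ht => (Finset.mem_filter.1 ht).2) hA hR₁ hR
    (Rw := Λ.rE a' (tgt e) du) (fun d hd => mem_graphBall_of_mem_VWin (hDE' hd)) fun d hd d' hd' => ?_
  exact C.sub_mem_box_of_mem_EfarN (φ_mem_of_mem_VWin (hDE' hd)) (φ_mem_of_mem_VWin (hDE' hd'))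

end Skel

end Transplant

end Summit.CriticalPhenomena.PercolationContinuityZ3.Theorems

end
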